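/-
Copyright (c) 2026. All rights reserved.
Released under Apache 2.0 license as described in the file LICENSE.
-/
import Mathlib
import Literature.Combinatorics.Hinz2018.RegularToPerfect

/-!
# Hinz–Klavžar–Petr, *The Tower of Hanoi – Myths and Maths* (2018), 2.2.2: Random Moves

[cite: HinzKlavzarPetr2018, Ch. 2 §2.2.2 (pp. 117–119): Theorem 2.23, (2.9), (2.10)]

Andreas M. Hinz, Sandi Klavžar, Ciril Petr, *The Tower of Hanoi – Myths and Maths*, second
edition, Birkhäuser/Springer, Cham, 2018 (ISBN 978-3-319-73778-2), Chapter 2 «The Classical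
Tower of Hanoi», Section 2.2 «Regular to Perfect», subsection 2.2.2 «Tower of Hanoi with Random
Moves», read whole in the held text `book:hinz2018-tower-hanoi-myths-maths` (chunks p0117, from
the heading of 2.2.2, to p0119, up to the heading of Section 2.3 «Hanoi Graphs»; the book's index
entry «Alekseyev, M. A., 118» (chunk p0390) confirms that chunk p0118 is printed page 118, so the
subsection occupies printed pp. 117–119). The subsection reports the results of M. A. Alekseyev
and T. Berger ([3] of the book = *Solving the Tower of Hanoi with Random Moves*, in: Beineke and
Rosenhouse (eds.), *The Mathematics of Various Entertaining Subjects*, Princeton 2016, Chapter 5;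
arXiv:1304.3780, whose displayed formulae for `E_{1→a}`, `E_{1→3}`, `E_{r→a}`, `E_{r→1}`,
`E_{½→a}` and `p_2(n)` were compared with the statements below) as Theorem 2.23 WITHOUT proof,
and proves its first formula from two renewal identities (2.9), (2.10). This module continues the
siblings `Hinz2018/PerfectToPerfect` (§2.1: legal moves `HanoiMove`, perfect states
`IsPerfectOn`) and `Hinz2018/RegularToPerfect` (§2.2: `stateOf`, the distance `p1Dist` and the
optimal path `p1Path` of Theorem 2.7 with `p1Path_zero`, `p1Path_last`, `p1Path_hanoiMove`,
`p1Path_frozen`, and `HanoiMove.symm`), all used BY NAME.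

## The text and what is typed

* **The tasks** (first paragraph): states of `T^n` as words `Fin n → ZMod 3` (`wordOf`,
  `stateOf` of the sibling; `stateOf_wordOf`, `wordOf_stateOf`), a legal move between words
  (`WordMove`), the finite set of legal moves out of a state (`moveFinset`, `mem_moveFinset`; disc
  1 can always move: `update_zero_mem_moveFinset`, `moveFinset_nonempty`), «the next move is
  chosen uniformly from the set of current legal moves»: the expected number of moves `d_e` is
  typed by FIRST-STEP ANALYSIS (OUR READING, see below): `IsHittingSolution n A h` (the linear
  first-step system for the expected number of random moves to reach the target set `A`),
  `IsTaskValue n A f v` (start in `f`; «To make this task non-trivial, it is required that at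
  least one disc is moved»), `IsMeanTaskValue n A v` (uniformly random initial state `r`, no move
  forced), the perfect states `perfectWord`, `perfectWords` and the state `10^{n-1}`
  (`oneZeroWord`). PROVED: the first-step system has AT MOST ONE solution whenever the target
  contains a perfect state (`hittingSolution_unique`, by the maximum principle
  `IsHittingSolution.eq_max_of_mem` propagated along the legal path of Theorem 2.7, `p1WordPath`,
  `p1WordPath_move`, `IsHittingSolution.le`), hence every task has at most one value
  (`taskValue_unique`, `meanTaskValue_unique`) — so the named facts below determine `d_e`.
* **Theorem 2.23** (Alekseyev–Berger; stated in the book without proof except for the first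
  formula) as four NAMED FACTS `AlekseyevBergerI`–`AlekseyevBergerIV` (`Theorem_2_23` is their
  conjunction): `d_e(0^n, i^n) = (3^n-1)/2`, `d_e(0^n, 2^n) = (3^n-1)(5^n-3^n)/(2·3^(n-1))`,
  `d_e(r, i^n) = (5^n - 2·3^n + 1)/4`, `d_e(r, 0^n) = ((3^n-1)(5^(n+1)-2·3^(n+1))+5^n-3^n)/(4·3^n)`,
  and the auxiliary result of [3] quoted in the text, `d_e(10^{n-1}, i^n) = 3(5^(n-1)-3^(n-1))/2`
  (`AlekseyevBergerOneZero`). PROVED for ONE DISC from the definitions (every state of `T^1` is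
  perfect; the first-step solutions are `0` resp. `hitOne`): `alekseyevBergerI_one` (value `1`),
  `alekseyevBergerII_one` (`2`), `alekseyevBergerIII_one` (`0`), `alekseyevBergerIV_one` (`4/3`),
  `alekseyevBergerOneZero_one` (`0`), with `mem_moveFinset_one`, `card_moveFinset_one`,
  `sum_words_one`, `isHittingSolution_hitOne`, and `taskValue_one_eq` (uniqueness in action).
* **The proof of the first formula** (pp. 118–119), typed as algebra over the quantities it
  names (`a = d_e(0^n, i^n)`, `a' = d_e(0^{n-1}, i^{n-1})`, `b = d_e(10^{n-1}, i^n)`, `p₀`, `p₁`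
  with «It is clear that p_1(n) = p_2(n) , so that p_0(n) + 2p_1(n) = 1»): (2.9)
  `a = a' + 2 p₁ b` and (2.10) `b = 1/2 + a' + (p₀ + p₁) b` are HYPOTHESES (their derivation
  in the text is a renewal argument about the random process, not typed); PROVED: the rewritten
  (2.10) `p₁ b = 1/2 + a'` (`eq_2_10_solved`), the recurrence `a = 3a' + 1`
  (`eq_2_9_recurrence`), «The solution of this recurrence, together with the initial condition»
  `d_e(0, i) = 1`: `(3^n - 1)/2` (`recurrence_three_mul_add_one`, `theorem_2_23_i_of_eqs`), the
  series `Σ_{k=1}^{∞} 3^{-k} = 1/2` of the proof of (2.10) (`tsum_third_pow_succ`), and the value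
  `p₁(m) = 3^(m-1)/(5^m - 3^m)` these relations force (`p₁_formula`; displayed in [3], not in the
  text).
* **The numerical remark**: `576 008 < d_e(0^8, 2^8) < 576 008.2` and `805.9 < d_e(0^4, 2^4) < 806`
  for the second formula (`remark_eight_discs`, `remark_four_discs`).

## Modelling decisions (OUR READING, said so)

* The book defines `d_e` as an expectation over the random sequence of moves; probability on
  path space is not set up here. We type `d_e` through the first-step (Dirichlet) equations that
  characterise expected hitting times of a random walk on a finite graph: `h = 0` on the target,
  `deg(f) · h(f) = deg(f) + Σ_{g ∼ f} h(g)` off it, a forced first move as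
  `deg(f) (v - 1) = Σ_{g ∼ f} h(g)`, a random initial state as `3^n v = Σ_r h(r)`. Uniqueness of
  the solution is PROVED; existence (and the identification with the probabilistic expectation)
  is not needed to state the named facts and is not claimed. The model was cross-checked outside
  Lean by exact rational first-step computations for `n ≤ 4` (all five formulas, (2.9), (2.10)).
* The book's `ℕ` starts at `1`; the named facts quantify over `n ≥ 1` (for `n = 0` there is no
  legal move and the forced-move condition would hold vacuously).
* In the second task the first move is forced as well (immaterial: `0^n ≠ 2^n`); in the third and
  fourth tasks no move is forced (for `n = 1` the third formula gives `0`), as in [3].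
* Pegs are `ZMod 3` = the book's `0, 1, 2`; [3] numbers them `1, 2, 3` (its `p_2` is the book's
  `p_1`).

## NOT TYPED (said so)

The probabilistic derivations of (2.9) and (2.10) (stopping-time / renewal arguments) beyond the
series `Σ 3^{-k} = 1/2`; the proofs of Theorem 2.23 in [3] (generating functions, and for the
second task «networks of electrical resistors»); the comparison with the ape of *Rise of the
Planet of the Apes*; the reference to Section 1.1 (random play of the Chinese Rings, typed in the
sibling `Hinz2018/ChineseRings` only by its two closing numbers — Wiesenberger's `d_e` is not
typed there either); Section 2.3 «Hanoi Graphs» onwards, which is a later anchor.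
-/

namespace Literature.Combinatorics.Hinz2018

open Finset

/-! ## Random moves on `T^n`: states as words, legal-move neighbourhoods -/

/-- The word of a state: entry `i` is the peg of disc `i + 1`.
[cite: HinzKlavzarPetr2018, Ch. 2 §2.2.2 p. 118 (the tasks); §2.2 Thm. 2.6 (T^n)] -/
def wordOf (n : ℕ) (s : ℕ → ZMod 3) : Fin n → ZMod 3 := fun i => s (i.val + 1)

/-- Outside the discs `1, …, n` the state `stateOf f` reads peg `0`.
[cite: HinzKlavzarPetr2018, Ch. 2 §2.2.2 p. 118 (the tasks); §2.2 Thm. 2.6 (T^n)] -/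
theorem stateOf_outside {n : ℕ} (f : Fin n → ZMod 3) {d : ℕ} (hd : d = 0 ∨ n < d) :
    stateOf f d = 0 := by
  unfold stateOf
  rw [dif_neg]
  omega

/-- On the discs `1, …, n` the state `stateOf f` reads the word.
[cite: HinzKlavzarPetr2018, Ch. 2 §2.2.2 p. 118 (the tasks); §2.2 Thm. 2.6 (T^n)] -/
theorem stateOf_disc {n : ℕ} (f : Fin n → ZMod 3) (i : Fin n) :
    stateOf f (i.val + 1) = f i := by
  unfold stateOf
  rw [dif_pos ⟨by omega, by omega⟩]
  congr 1

/-- The word of the state of a word is the word.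
[cite: HinzKlavzarPetr2018, Ch. 2 §2.2.2 p. 118 (the tasks); §2.2 Thm. 2.6 (T^n)] -/
theorem wordOf_stateOf {n : ℕ} (f : Fin n → ZMod 3) : wordOf n (stateOf f) = f := by
  funext i
  exact stateOf_disc f i

/-- A state supported on the discs `1, …, n` is the state of its word.
[cite: HinzKlavzarPetr2018, Ch. 2 §2.2.2 p. 118 (the tasks); §2.2 Thm. 2.6 (T^n)] -/
theorem stateOf_wordOf {n : ℕ} {s : ℕ → ZMod 3} (hs : ∀ d, d = 0 ∨ n < d → s d = 0) :
    stateOf (wordOf n s) = s := by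
  funext d
  by_cases h : 1 ≤ d ∧ d ≤ n
  · have : d = (⟨d - 1, by omega⟩ : Fin n).val + 1 := by simp; omega
    conv_lhs => rw [this]
    rw [stateOf_disc]
    simp only [wordOf]
    congr 1
    omega
  · rw [stateOf_outside _ (by omega), hs d (by omega)]

/-- A legal move between two states of `T^n`, given by their words.
[cite: HinzKlavzarPetr2018, Ch. 2 §2.2.2 p. 118 (the tasks); §2.2 Thm. 2.6 (T^n)] -/
def WordMove (n : ℕ) (f g : Fin n → ZMod 3) : Prop := HanoiMove n (stateOf f) (stateOf g)

/-- Legal moves are reversible (sibling `HanoiMove.symm`).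
[cite: HinzKlavzarPetr2018, Ch. 2 §2.2.2 p. 118 (the tasks); §2.2 Thm. 2.6 (T^n)] -/
theorem WordMove.symm {n : ℕ} {f g : Fin n → ZMod 3} (h : WordMove n f g) : WordMove n g f :=
  HanoiMove.symm h

/-- The states reachable from `f` by one legal move (the neighbourhood of `f` in the state
graph), as a finite set.
[cite: HinzKlavzarPetr2018, Ch. 2 §2.2.2 p. 118 (the tasks); §2.2 Thm. 2.6 (T^n)] -/
noncomputable def moveFinset (n : ℕ) (f : Fin n → ZMod 3) : Finset (Fin n → ZMod 3) :=
  (Set.toFinite {g | WordMove n f g}).toFinset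

/-- Membership in the neighbourhood is a legal move.
[cite: HinzKlavzarPetr2018, Ch. 2 §2.2.2 p. 118 (the tasks); §2.2 Thm. 2.6 (T^n)] -/
theorem mem_moveFinset {n : ℕ} {f g : Fin n → ZMod 3} :
    g ∈ moveFinset n f ↔ WordMove n f g := by
  simp [moveFinset]

/-- Disc 1 may always be moved to any other peg.
[cite: HinzKlavzarPetr2018, Ch. 2 §2.2.2 p. 118 (the tasks); §2.2 Thm. 2.6 (T^n)] -/
theorem update_zero_mem_moveFinset {n : ℕ} (hn : 1 ≤ n) (f : Fin n → ZMod 3) {c : ZMod 3}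
    (hc : c ≠ f ⟨0, hn⟩) : Function.update f ⟨0, hn⟩ c ∈ moveFinset n f := by
  rw [mem_moveFinset]
  refine ⟨1, le_rfl, hn, ?_, ?_, fun e he1 he2 => by omega⟩
  · have h1 := stateOf_disc f ⟨0, hn⟩
    have h2 := stateOf_disc (Function.update f ⟨0, hn⟩ c) ⟨0, hn⟩
    simp only [zero_add] at h1 h2
    rw [h1, h2, Function.update_self]
    exact hc.symm
  · intro e he
    by_cases hr : 1 ≤ e ∧ e ≤ n
    · have : e = (⟨e - 1, by omega⟩ : Fin n).val + 1 := by simp; omega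
      rw [this, stateOf_disc, stateOf_disc, Function.update_of_ne]
      exact fun H => he (by rw [Fin.ext_iff] at H; simp at H; omega)
    · rw [stateOf_outside _ (by omega), stateOf_outside _ (by omega)]

/-- Every state of `T^n`, `n ≥ 1`, admits a legal move.
[cite: HinzKlavzarPetr2018, Ch. 2 §2.2.2 p. 118 (the tasks); §2.2 Thm. 2.6 (T^n)] -/
theorem moveFinset_nonempty {n : ℕ} (hn : 1 ≤ n) (f : Fin n → ZMod 3) :
    (moveFinset n f).Nonempty := by
  refine ⟨Function.update f ⟨0, hn⟩ (f ⟨0, hn⟩ + 1), update_zero_mem_moveFinset hn f ?_⟩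
  intro h
  have : (1 : ZMod 3) = 0 := by
    calc (1 : ZMod 3) = f ⟨0, hn⟩ + 1 - f ⟨0, hn⟩ := by ring
      _ = 0 := by rw [h, sub_self]
  exact absurd this (by decide)

/-- The degree of every state of `T^n`, `n ≥ 1`, is positive.
[cite: HinzKlavzarPetr2018, Ch. 2 §2.2.2 p. 118 (the tasks); §2.2 Thm. 2.6 (T^n)] -/
theorem moveFinset_card_pos {n : ℕ} (hn : 1 ≤ n) (f : Fin n → ZMod 3) :
    0 < (moveFinset n f).card :=
  Finset.card_pos.mpr (moveFinset_nonempty hn f)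

/-! ## First-step analysis: expected number of random moves -/

/-- The first-step (Dirichlet) system for the expected number of uniformly random legal moves
needed to reach the target set `A`: `h = 0` on `A`, and off `A`
`h(f) = 1 + (1 / deg f) · Σ_{g ∼ f} h(g)`, cleared of the denominator.
[cite: HinzKlavzarPetr2018, Ch. 2 §2.2.2 p. 118 (the tasks; OUR READING: first-step equations)] -/
def IsHittingSolution (n : ℕ) (A : Set (Fin n → ZMod 3)) (h : (Fin n → ZMod 3) → ℝ) : Prop :=
  (∀ f ∈ A, h f = 0) ∧
    ∀ f ∉ A, ((moveFinset n f).card : ℝ) * h f =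
      (moveFinset n f).card + ∑ g ∈ moveFinset n f, h g

/-- `v` is the expected number of moves of the task: start in `f`, make uniformly random legal
moves, at least one, until a state of `A` is reached (`v = 1 + (1 / deg f) Σ_{g ∼ f} h(g)`).
[cite: HinzKlavzarPetr2018, Ch. 2 §2.2.2 p. 118 (the tasks; OUR READING: first-step equations)] -/
def IsTaskValue (n : ℕ) (A : Set (Fin n → ZMod 3)) (f : Fin n → ZMod 3) (v : ℝ) : Prop :=
  ∃ h, IsHittingSolution n A h ∧
    ((moveFinset n f).card : ℝ) * (v - 1) = ∑ g ∈ moveFinset n f, h g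

/-- `v` is the expected number of random moves until a state of `A` is reached, the initial
state `r ∈ T^n` being uniformly random (no move is forced: `v = 3^{-n} Σ_r h(r)`).
[cite: HinzKlavzarPetr2018, Ch. 2 §2.2.2 p. 118 (the tasks; OUR READING: first-step equations)] -/
def IsMeanTaskValue (n : ℕ) (A : Set (Fin n → ZMod 3)) (v : ℝ) : Prop :=
  ∃ h, IsHittingSolution n A h ∧ (3 : ℝ) ^ n * v = ∑ r : Fin n → ZMod 3, h r

/-- The perfect state `i^n` as a word.
[cite: HinzKlavzarPetr2018, Ch. 2 §2.2.2 p. 118 (the tasks; OUR READING: first-step equations)] -/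
def perfectWord (n : ℕ) (i : ZMod 3) : Fin n → ZMod 3 := fun _ => i

/-- The set of the three perfect states `0^n, 1^n, 2^n`.
[cite: HinzKlavzarPetr2018, Ch. 2 §2.2.2 p. 118 (the tasks; OUR READING: first-step equations)] -/
def perfectWords (n : ℕ) : Set (Fin n → ZMod 3) := Set.range (perfectWord n)

/-- The state of the word `i^n` is the perfect state on peg `i`.
[cite: HinzKlavzarPetr2018, Ch. 2 §2.2.2 p. 118 (the tasks; OUR READING: first-step equations)] -/
theorem isPerfectOn_stateOf_perfectWord (n : ℕ) (i : ZMod 3) :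
    IsPerfectOn n (stateOf (perfectWord n i)) i := by
  intro d hd1 hdn
  have : d = (⟨d - 1, by omega⟩ : Fin n).val + 1 := by simp; omega
  rw [this, stateOf_disc]
  rfl

/-- A perfect state has the constant word.
[cite: HinzKlavzarPetr2018, Ch. 2 §2.2.2 p. 118 (the tasks; OUR READING: first-step equations)] -/
theorem wordOf_eq_perfectWord {n : ℕ} {s : ℕ → ZMod 3} {i : ZMod 3} (hs : IsPerfectOn n s i) :
    wordOf n s = perfectWord n i := by
  funext k
  exact hs (k.val + 1) (by omega) (by omega)

/-! ### Uniqueness of the first-step solution (maximum principle) -/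

/-- The word path of Theorem 2.7 from `f` to the perfect state `j^n`.
[cite: HinzKlavzarPetr2018, Ch. 2 §2.2.2 p. 118 (OUR READING); §2.2 Thm. 2.7 (paths)] -/
noncomputable def p1WordPath (n : ℕ) (f : Fin n → ZMod 3) (j : ZMod 3) (k : ℕ) : Fin n → ZMod 3 :=
  wordOf n (p1Path n (stateOf f) j k)

/-- The states along the word path are the states of Theorem 2.7's path.
[cite: HinzKlavzarPetr2018, Ch. 2 §2.2.2 p. 118 (OUR READING); §2.2 Thm. 2.7 (paths)] -/
theorem stateOf_p1WordPath (n : ℕ) (f : Fin n → ZMod 3) (j : ZMod 3) (k : ℕ) :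
    stateOf (p1WordPath n f j k) = p1Path n (stateOf f) j k :=
  stateOf_wordOf fun d hd => by rw [p1Path_frozen n _ j k hd, stateOf_outside f hd]

/-- The word path starts in `f`.
[cite: HinzKlavzarPetr2018, Ch. 2 §2.2.2 p. 118 (OUR READING); §2.2 Thm. 2.7 (paths)] -/
theorem p1WordPath_zero (n : ℕ) (f : Fin n → ZMod 3) (j : ZMod 3) : p1WordPath n f j 0 = f := by
  unfold p1WordPath
  rw [p1Path_zero, wordOf_stateOf]

/-- The word path ends in `j^n` after `d(s, j^n)` steps.
[cite: HinzKlavzarPetr2018, Ch. 2 §2.2.2 p. 118 (OUR READING); §2.2 Thm. 2.7 (paths)] -/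
theorem p1WordPath_last (n : ℕ) (f : Fin n → ZMod 3) (j : ZMod 3) :
    p1WordPath n f j (p1Dist n (stateOf f) j) = perfectWord n j :=
  wordOf_eq_perfectWord (p1Path_last n _ j)

/-- Consecutive states of the word path are joined by a legal move.
[cite: HinzKlavzarPetr2018, Ch. 2 §2.2.2 p. 118 (OUR READING); §2.2 Thm. 2.7 (paths)] -/
theorem p1WordPath_move (n : ℕ) (f : Fin n → ZMod 3) (j : ZMod 3) {k : ℕ}
    (hk : k < p1Dist n (stateOf f) j) :
    p1WordPath n f j (k + 1) ∈ moveFinset n (p1WordPath n f j k) := by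
  rw [mem_moveFinset, WordMove, stateOf_p1WordPath, stateOf_p1WordPath]
  exact p1Path_hanoiMove n _ j k hk

/-- The difference of two first-step solutions has the mean-value property off `A`.
[cite: HinzKlavzarPetr2018, Ch. 2 §2.2.2 p. 118 (OUR READING); §2.2 Thm. 2.7 (paths)] -/
theorem IsHittingSolution.sub_meanValue {n : ℕ} {A : Set (Fin n → ZMod 3)}
    {h₁ h₂ : (Fin n → ZMod 3) → ℝ} (H₁ : IsHittingSolution n A h₁)
    (H₂ : IsHittingSolution n A h₂) {f : Fin n → ZMod 3} (hf : f ∉ A) :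
    ((moveFinset n f).card : ℝ) * (h₁ f - h₂ f) = ∑ g ∈ moveFinset n f, (h₁ g - h₂ g) := by
  rw [Finset.sum_sub_distrib, mul_sub, H₁.2 f hf, H₂.2 f hf]
  ring

/-- Maximum principle: if the difference `u = h₁ - h₂` attains its maximum `M` at `f ∉ A`, then
`u = M` at every neighbour of `f`.
[cite: HinzKlavzarPetr2018, Ch. 2 §2.2.2 p. 118 (OUR READING); §2.2 Thm. 2.7 (paths)] -/
theorem IsHittingSolution.eq_max_of_mem {n : ℕ} {A : Set (Fin n → ZMod 3)}
    {h₁ h₂ : (Fin n → ZMod 3) → ℝ} (H₁ : IsHittingSolution n A h₁)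
    (H₂ : IsHittingSolution n A h₂) {f : Fin n → ZMod 3} (hf : f ∉ A)
    (hmax : ∀ g, h₁ g - h₂ g ≤ h₁ f - h₂ f) {g : Fin n → ZMod 3} (hg : g ∈ moveFinset n f) :
    h₁ g - h₂ g = h₁ f - h₂ f := by
  have key : ∑ x ∈ moveFinset n f, ((h₁ f - h₂ f) - (h₁ x - h₂ x)) = 0 := by
    rw [Finset.sum_sub_distrib, Finset.sum_const, nsmul_eq_mul, ← H₁.sub_meanValue H₂ hf, sub_self]
  have := (Finset.sum_eq_zero_iff_of_nonneg fun x _ => sub_nonneg.mpr (hmax x)).mp key g hg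
  linarith

/-- One-sided comparison of two first-step solutions.
[cite: HinzKlavzarPetr2018, Ch. 2 §2.2.2 p. 118 (OUR READING); §2.2 Thm. 2.7 (paths)] -/
theorem IsHittingSolution.le {n : ℕ} {A : Set (Fin n → ZMod 3)} {j : ZMod 3}
    (hA : perfectWord n j ∈ A) {h₁ h₂ : (Fin n → ZMod 3) → ℝ} (H₁ : IsHittingSolution n A h₁)
    (H₂ : IsHittingSolution n A h₂) (f : Fin n → ZMod 3) : h₁ f ≤ h₂ f := by
  obtain ⟨f₀, -, hf₀⟩ :=
    Finset.exists_max_image Finset.univ (fun g => h₁ g - h₂ g) ⟨f, Finset.mem_univ f⟩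
  have hmax : ∀ g, h₁ g - h₂ g ≤ h₁ f₀ - h₂ f₀ := fun g => hf₀ g (Finset.mem_univ g)
  suffices hM : h₁ f₀ - h₂ f₀ ≤ 0 by linarith [hmax f]
  by_contra hM
  rw [not_le] at hM
  set L := p1Dist n (stateOf f₀) j with hL
  have key : ∀ k, k ≤ L → p1WordPath n f₀ j k ∉ A ∧
      h₁ (p1WordPath n f₀ j k) - h₂ (p1WordPath n f₀ j k) = h₁ f₀ - h₂ f₀ := by
    intro k
    induction k with
    | zero =>
      intro _
      rw [p1WordPath_zero]
      refine ⟨fun hmem => ?_, rfl⟩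
      rw [H₁.1 f₀ hmem, H₂.1 f₀ hmem, sub_self] at hM
      exact lt_irrefl 0 hM
    | succ k ih =>
      intro hk
      obtain ⟨hnot, heq⟩ := ih (by omega)
      have hmax' : ∀ g, h₁ g - h₂ g ≤
          h₁ (p1WordPath n f₀ j k) - h₂ (p1WordPath n f₀ j k) := by
        rw [heq]; exact hmax
      have hstep := H₁.eq_max_of_mem H₂ hnot hmax' (p1WordPath_move n f₀ j (by omega))
      rw [heq] at hstep
      refine ⟨fun hmem => ?_, hstep⟩
      rw [H₁.1 _ hmem, H₂.1 _ hmem, sub_self] at hstep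
      rw [← hstep] at hM
      exact lt_irrefl 0 hM
  have := (key L le_rfl).1
  rw [p1WordPath_last] at this
  exact this hA

/-- The first-step system has at most one solution as soon as the target set contains a perfect
state (every state is joined to it by the legal path of Theorem 2.7).
[cite: HinzKlavzarPetr2018, Ch. 2 §2.2.2 p. 118 (OUR READING); §2.2 Thm. 2.7 (paths)] -/
theorem hittingSolution_unique {n : ℕ} {A : Set (Fin n → ZMod 3)} {j : ZMod 3}
    (hA : perfectWord n j ∈ A) {h₁ h₂ : (Fin n → ZMod 3) → ℝ} (H₁ : IsHittingSolution n A h₁)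
    (H₂ : IsHittingSolution n A h₂) : h₁ = h₂ :=
  funext fun f => le_antisymm (H₁.le hA H₂ f) (H₂.le hA H₁ f)

/-- Hence a task has at most one value.
[cite: HinzKlavzarPetr2018, Ch. 2 §2.2.2 p. 118 (OUR READING); §2.2 Thm. 2.7 (paths)] -/
theorem taskValue_unique {n : ℕ} (hn : 1 ≤ n) {A : Set (Fin n → ZMod 3)} {j : ZMod 3}
    (hA : perfectWord n j ∈ A) {f : Fin n → ZMod 3} {v w : ℝ} (hv : IsTaskValue n A f v)
    (hw : IsTaskValue n A f w) : v = w := by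
  obtain ⟨h₁, H₁, e₁⟩ := hv
  obtain ⟨h₂, H₂, e₂⟩ := hw
  rw [hittingSolution_unique hA H₁ H₂, ← e₂] at e₁
  have hc : (0 : ℝ) < (moveFinset n f).card := by exact_mod_cast moveFinset_card_pos hn f
  have := mul_left_cancel₀ hc.ne' e₁
  linarith

/-- And a task with uniformly random initial state has at most one value.
[cite: HinzKlavzarPetr2018, Ch. 2 §2.2.2 p. 118 (OUR READING); §2.2 Thm. 2.7 (paths)] -/
theorem meanTaskValue_unique {n : ℕ} {A : Set (Fin n → ZMod 3)} {j : ZMod 3}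
    (hA : perfectWord n j ∈ A) {v w : ℝ} (hv : IsMeanTaskValue n A v)
    (hw : IsMeanTaskValue n A w) : v = w := by
  obtain ⟨h₁, H₁, e₁⟩ := hv
  obtain ⟨h₂, H₂, e₂⟩ := hw
  rw [hittingSolution_unique hA H₁ H₂, ← e₂] at e₁
  exact mul_left_cancel₀ (by positivity) e₁

/-! ### One disc: the definitions evaluated on `T^1` -/

/-- Every state of one disc is perfect.
[cite: HinzKlavzarPetr2018, Ch. 2 §2.2.2 Thm. 2.23 (n = 1)] -/
theorem mem_perfectWords_one (f : Fin 1 → ZMod 3) : f ∈ perfectWords 1 :=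
  ⟨f 0, funext fun i => by rw [Fin.fin_one_eq_zero i]; rfl⟩

/-- A word of length one is the constant word of its letter.
[cite: HinzKlavzarPetr2018, Ch. 2 §2.2.2 Thm. 2.23 (n = 1)] -/
theorem eq_perfectWord_one (f : Fin 1 → ZMod 3) : f = perfectWord 1 (f 0) :=
  funext fun i => by rw [Fin.fin_one_eq_zero i]; rfl

/-- With one disc, the legal moves from `f` lead to the two other states.
[cite: HinzKlavzarPetr2018, Ch. 2 §2.2.2 Thm. 2.23 (n = 1)] -/
theorem mem_moveFinset_one {f g : Fin 1 → ZMod 3} : g ∈ moveFinset 1 f ↔ g ≠ f := by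
  constructor
  · intro h hgf
    rw [hgf, mem_moveFinset] at h
    obtain ⟨d, -, -, hne, -, -⟩ := h
    exact hne rfl
  · intro hgf
    have hg : g = Function.update f ⟨0, Nat.one_pos⟩ (g 0) := by
      rw [eq_perfectWord_one g]
      funext i
      rw [Fin.fin_one_eq_zero i]
      simp [perfectWord]
    rw [hg]
    refine update_zero_mem_moveFinset le_rfl f fun h0 => hgf ?_
    rw [eq_perfectWord_one g, eq_perfectWord_one f]
    exact congrArg _ h0

/-- With one disc the neighbourhood of `f` consists of the two other states.
[cite: HinzKlavzarPetr2018, Ch. 2 §2.2.2 Thm. 2.23 (n = 1)] -/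
theorem moveFinset_one (f : Fin 1 → ZMod 3) : moveFinset 1 f = Finset.univ.erase f := by
  ext g
  rw [mem_moveFinset_one, Finset.mem_erase]
  simp

/-- With one disc every state has exactly two legal moves.
[cite: HinzKlavzarPetr2018, Ch. 2 §2.2.2 Thm. 2.23 (n = 1)] -/
theorem card_moveFinset_one (f : Fin 1 → ZMod 3) : (moveFinset 1 f).card = 2 := by
  rw [moveFinset_one, Finset.card_erase_of_mem (Finset.mem_univ f), Finset.card_univ,
    Fintype.card_fun, ZMod.card, Fintype.card_fin]
  rfl

/-- Sums over `T^1` are sums over the three perfect states.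
[cite: HinzKlavzarPetr2018, Ch. 2 §2.2.2 Thm. 2.23 (n = 1)] -/
theorem sum_words_one (F : (Fin 1 → ZMod 3) → ℝ) :
    ∑ g : Fin 1 → ZMod 3, F g =
      F (perfectWord 1 0) + F (perfectWord 1 1) + F (perfectWord 1 2) := by
  rw [← (Equiv.funUnique (Fin 1) (ZMod 3)).symm.sum_comp]
  show ∑ c : Fin 3, F ((Equiv.funUnique (Fin 1) (ZMod 3)).symm c) = _
  rw [Fin.sum_univ_three]
  rfl

/-- Distinct pegs give distinct one-disc states.
[cite: HinzKlavzarPetr2018, Ch. 2 §2.2.2 Thm. 2.23 (n = 1)] -/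
theorem perfectWord_one_injective {i j : ZMod 3} (h : perfectWord 1 i = perfectWord 1 j) : i = j :=
  congrFun h 0

/-! ## Theorem 2.23 (Alekseyev and Berger) — named facts -/

/-- NAMED FACT (Theorem 2.23, first formula; Alekseyev–Berger): starting from the perfect state
`0^n` and moving uniformly at random (at least once) until an arbitrary perfect state is reached
takes `(3^n - 1)/2` moves on average. Unproved here (the text derives it from (2.9), (2.10):
see `theorem_2_23_i_of_eqs`).
[cite: HinzKlavzarPetr2018, Ch. 2 §2.2.2 Thm. 2.23, p. 118 (NAMED FACT)] -/
def AlekseyevBergerI : Prop :=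
  ∀ n : ℕ, 1 ≤ n → IsTaskValue n (perfectWords n) (perfectWord n 0) (((3 : ℝ) ^ n - 1) / 2)

/-- NAMED FACT (Theorem 2.23, second formula): from `0^n` randomly to the perfect state `2^n`
takes `(3^n - 1)(5^n - 3^n) / (2 · 3^(n-1))` moves on average.
[cite: HinzKlavzarPetr2018, Ch. 2 §2.2.2 Thm. 2.23, p. 118 (NAMED FACT)] -/
def AlekseyevBergerII : Prop :=
  ∀ n : ℕ, 1 ≤ n → IsTaskValue n {perfectWord n 2} (perfectWord n 0)
    (((3 : ℝ) ^ n - 1) * (5 ^ n - 3 ^ n) / (2 * 3 ^ (n - 1)))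

/-- NAMED FACT (Theorem 2.23, third formula): from a uniformly random state `r` to an arbitrary
perfect state takes `(5^n - 2 · 3^n + 1)/4` random moves on average.
[cite: HinzKlavzarPetr2018, Ch. 2 §2.2.2 Thm. 2.23, p. 118 (NAMED FACT)] -/
def AlekseyevBergerIII : Prop :=
  ∀ n : ℕ, 1 ≤ n → IsMeanTaskValue n (perfectWords n) (((5 : ℝ) ^ n - 2 * 3 ^ n + 1) / 4)

/-- NAMED FACT (Theorem 2.23, fourth formula): from a uniformly random state `r` to the perfect
state `0^n` takes `((3^n - 1)(5^(n+1) - 2 · 3^(n+1)) + 5^n - 3^n) / (4 · 3^n)` random moves on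
average. [cite: HinzKlavzarPetr2018, Ch. 2 §2.2.2 Thm. 2.23, p. 118 (NAMED FACT)] -/
def AlekseyevBergerIV : Prop :=
  ∀ n : ℕ, 1 ≤ n → IsMeanTaskValue n {perfectWord n 0}
    ((((3 : ℝ) ^ n - 1) * (5 ^ (n + 1) - 2 * 3 ^ (n + 1)) + 5 ^ n - 3 ^ n) / (4 * 3 ^ n))

/-- Theorem 2.23 as stated: the four formulas.
[cite: HinzKlavzarPetr2018, Ch. 2 §2.2.2 Thm. 2.23, p. 118 (NAMED FACT)] -/
def Theorem_2_23 : Prop :=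
  AlekseyevBergerI ∧ AlekseyevBergerII ∧ AlekseyevBergerIII ∧ AlekseyevBergerIV

/-- The state `1 0^(n-1)` (largest disc on peg `1`, all others on peg `0`), written `10^{n-1}`.
[cite: HinzKlavzarPetr2018, Ch. 2 §2.2.2 p. 118 (the result of [3] on 10^{n-1})] -/
def oneZeroWord (n : ℕ) : Fin n → ZMod 3 := fun i => if i.val + 1 = n then 1 else 0

/-- NAMED FACT (from [3], used in the proof of Theorem 2.23): reaching an arbitrary perfect
state randomly from `10^{n-1}` takes `3 (5^(n-1) - 3^(n-1)) / 2` moves on average.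
[cite: HinzKlavzarPetr2018, Ch. 2 §2.2.2 p. 118 (the result of [3] on 10^{n-1})] -/
def AlekseyevBergerOneZero : Prop :=
  ∀ n : ℕ, 1 ≤ n → ∃ h, IsHittingSolution n (perfectWords n) h ∧
    h (oneZeroWord n) = 3 * ((5 : ℝ) ^ (n - 1) - 3 ^ (n - 1)) / 2

/-! ### The five formulas hold for one disc (computed from the definitions) -/

/-- With one disc every state is perfect, so the first-step solution for the target
`perfectWords 1` is `0`.
[cite: HinzKlavzarPetr2018, Ch. 2 §2.2.2 Thm. 2.23 (n = 1, from the definitions)] -/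
theorem isHittingSolution_perfectWords_one : IsHittingSolution 1 (perfectWords 1) 0 :=
  ⟨fun _ _ => rfl, fun f hf => absurd (mem_perfectWords_one f) hf⟩

/-- The first-step solution for the single target `c^1`: `0` at `c^1`, `2` elsewhere (from the
other two states disc 1 hits peg `c` after a geometric number of moves with mean `2`).
[cite: HinzKlavzarPetr2018, Ch. 2 §2.2.2 Thm. 2.23 (n = 1, from the definitions)] -/
noncomputable def hitOne (c : ZMod 3) : (Fin 1 → ZMod 3) → ℝ :=
  fun g => if g = perfectWord 1 c then 0 else 2

/-- `Σ_g hitOne c g = 0 + 2 + 2 = 4`.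
[cite: HinzKlavzarPetr2018, Ch. 2 §2.2.2 Thm. 2.23 (n = 1, from the definitions)] -/
theorem sum_hitOne (c : ZMod 3) : ∑ g : Fin 1 → ZMod 3, hitOne c g = 4 := by
  have : ∀ g, hitOne c g = 2 - (if perfectWord 1 c = g then 2 else 0) := by
    intro g
    unfold hitOne
    split_ifs with h1 h2 h2
    · norm_num
    · exact absurd h1.symm h2
    · exact absurd h2.symm h1
    · norm_num
  simp_rw [this, Finset.sum_sub_distrib, Finset.sum_ite_eq, Finset.mem_univ, if_true,
    Finset.sum_const, Finset.card_univ, Fintype.card_fun, ZMod.card, Fintype.card_fin]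
  norm_num

/-- `hitOne c` solves the first-step system for the target `c^1`.
[cite: HinzKlavzarPetr2018, Ch. 2 §2.2.2 Thm. 2.23 (n = 1, from the definitions)] -/
theorem isHittingSolution_hitOne (c : ZMod 3) :
    IsHittingSolution 1 {perfectWord 1 c} (hitOne c) := by
  refine ⟨fun f hf => by simp [hitOne, Set.mem_singleton_iff.mp hf], fun f hf => ?_⟩
  have hf' : f ≠ perfectWord 1 c := hf
  rw [card_moveFinset_one, moveFinset_one, Finset.sum_erase_eq_sub (Finset.mem_univ f), sum_hitOne]
  simp [hitOne, hf']
  norm_num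

/-- `d_e(0^1, i^1) = 1 = (3^1 - 1)/2`.
[cite: HinzKlavzarPetr2018, Ch. 2 §2.2.2 Thm. 2.23 (n = 1, from the definitions)] -/
theorem alekseyevBergerI_one :
    IsTaskValue 1 (perfectWords 1) (perfectWord 1 0) (((3 : ℝ) ^ 1 - 1) / 2) :=
  ⟨0, isHittingSolution_perfectWords_one, by norm_num⟩

/-- `d_e(0^1, 2^1) = 2 = (3 - 1)(5 - 3)/(2 · 3^0)`.
[cite: HinzKlavzarPetr2018, Ch. 2 §2.2.2 Thm. 2.23 (n = 1, from the definitions)] -/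
theorem alekseyevBergerII_one :
    IsTaskValue 1 {perfectWord 1 2} (perfectWord 1 0)
      (((3 : ℝ) ^ 1 - 1) * (5 ^ 1 - 3 ^ 1) / (2 * 3 ^ (1 - 1))) := by
  refine ⟨hitOne 2, isHittingSolution_hitOne 2, ?_⟩
  rw [card_moveFinset_one, moveFinset_one, Finset.sum_erase_eq_sub (Finset.mem_univ _), sum_hitOne]
  have h02 : perfectWord 1 0 ≠ perfectWord 1 2 := fun h =>
    absurd (perfectWord_one_injective h) (by decide)
  simp only [hitOne, h02, if_false]
  norm_num

/-- `d_e(r, i^1) = 0 = (5 - 6 + 1)/4`.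
[cite: HinzKlavzarPetr2018, Ch. 2 §2.2.2 Thm. 2.23 (n = 1, from the definitions)] -/
theorem alekseyevBergerIII_one :
    IsMeanTaskValue 1 (perfectWords 1) (((5 : ℝ) ^ 1 - 2 * 3 ^ 1 + 1) / 4) :=
  ⟨0, isHittingSolution_perfectWords_one, by norm_num⟩

/-- `d_e(r, 0^1) = 4/3 = ((3 - 1)(25 - 18) + 5 - 3)/(4 · 3)`.
[cite: HinzKlavzarPetr2018, Ch. 2 §2.2.2 Thm. 2.23 (n = 1, from the definitions)] -/
theorem alekseyevBergerIV_one :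
    IsMeanTaskValue 1 {perfectWord 1 0}
      ((((3 : ℝ) ^ 1 - 1) * (5 ^ (1 + 1) - 2 * 3 ^ (1 + 1)) + 5 ^ 1 - 3 ^ 1) / (4 * 3 ^ 1)) := by
  refine ⟨hitOne 0, isHittingSolution_hitOne 0, ?_⟩
  rw [sum_hitOne]
  norm_num

/-- `d_e(10^0, i^1) = 0 = 3 (5^0 - 3^0)/2` (the state `1` is perfect).
[cite: HinzKlavzarPetr2018, Ch. 2 §2.2.2 p. 118 (the result of [3] on 10^{n-1})] -/
theorem alekseyevBergerOneZero_one :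
    ∃ h, IsHittingSolution 1 (perfectWords 1) h ∧
      h (oneZeroWord 1) = 3 * ((5 : ℝ) ^ (1 - 1) - 3 ^ (1 - 1)) / 2 :=
  ⟨0, isHittingSolution_perfectWords_one, by simp⟩

/-- By uniqueness, the named facts pin the values down: e.g. any value of the first task with
one disc is `1`.
[cite: HinzKlavzarPetr2018, Ch. 2 §2.2.2 Thm. 2.23 (n = 1, from the definitions)] -/
theorem taskValue_one_eq {v : ℝ} (hv : IsTaskValue 1 (perfectWords 1) (perfectWord 1 0) v) :
    v = 1 := by
  have := taskValue_unique (A := perfectWords 1) le_rfl (Set.mem_range_self (0 : ZMod 3)) hv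
    alekseyevBergerI_one
  rw [this]
  norm_num

/-! ## The proof of the first formula: (2.9), (2.10) and the recurrence -/

/-- In the proof of (2.10), «the expected number of moves of disc n at the start of the game is»
`Σ_{k=1}^{∞} 3^{-k} = 1/2`. [cite: HinzKlavzarPetr2018, Ch. 2 §2.2.2 p. 119, proof of (2.10)] -/
theorem tsum_third_pow_succ : ∑' k : ℕ, (1 / 3 : ℝ) ^ (k + 1) = 1 / 2 := by
  have h3 : (1 / 3 : ℝ) < 1 := by norm_num
  have h0 : (0 : ℝ) ≤ 1 / 3 := by norm_num
  simp_rw [pow_succ]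
  rw [(summable_geometric_of_lt_one h0 h3).tsum_mul_right, tsum_geometric_of_lt_one h0 h3]
  norm_num

/-- From (2.10) and `p₀ + 2 p₁ = 1` (that is `p₀ + p₁ = 1 - p₁`):
`p₁(n-1) d_e(10^{n-1}, i^n) = 1/2 + d_e(0^{n-1}, i^{n-1})`.
[cite: HinzKlavzarPetr2018, Ch. 2 §2.2.2 p. 119, (2.10) rewritten] -/
theorem eq_2_10_solved {a' b p₀ p₁ : ℝ} (hp : p₀ + 2 * p₁ = 1)
    (h210 : b = 1 / 2 + a' + (p₀ + p₁) * b) : p₁ * b = 1 / 2 + a' := by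
  linear_combination h210 + b * hp

/-- Inserting into (2.9): `d_e(0^n, i^n) = 3 d_e(0^{n-1}, i^{n-1}) + 1`.
[cite: HinzKlavzarPetr2018, Ch. 2 §2.2.2 p. 119, (2.9) and the recurrence] -/
theorem eq_2_9_recurrence {a a' b p₀ p₁ : ℝ} (hp : p₀ + 2 * p₁ = 1)
    (h29 : a = a' + 2 * p₁ * b) (h210 : b = 1 / 2 + a' + (p₀ + p₁) * b) : a = 3 * a' + 1 := by
  linear_combination h29 + 2 * h210 + 2 * b * hp

/-- The recurrence `a_n = 3 a_{n-1} + 1` with `a_1 = 1` has the solution `a_n = (3^n - 1)/2`.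
[cite: HinzKlavzarPetr2018, Ch. 2 §2.2.2 p. 119, end of the proof of Thm. 2.23 (first formula)] -/
theorem recurrence_three_mul_add_one {a : ℕ → ℝ} (h1 : a 1 = 1)
    (hrec : ∀ m, 1 ≤ m → a (m + 1) = 3 * a m + 1) : ∀ n, 1 ≤ n → a n = ((3 : ℝ) ^ n - 1) / 2 := by
  intro n hn
  induction n, hn using Nat.le_induction with
  | base => rw [h1]; norm_num
  | succ m hm ih => rw [hrec m hm, ih, pow_succ]; ring

/-- The derivation of the first formula of Theorem 2.23 in the text: with
`a n = d_e(0^n, i^n)`, `b n = d_e(10^{n-1}, i^n)`, `p₀ n, p₁ n` the probabilities that the task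
from `0^n` ends in `0^n` resp. `1^n` (`= p₂ n`), the relations (2.9), (2.10), `p₀ + 2 p₁ = 1` and
the initial condition `d_e(0, i) = 1` give `d_e(0^n, i^n) = (3^n - 1)/2`.
[cite: HinzKlavzarPetr2018, Ch. 2 §2.2.2 p. 119, end of the proof of Thm. 2.23 (first formula)] -/
theorem theorem_2_23_i_of_eqs (a b p₀ p₁ : ℕ → ℝ) (hp : ∀ m, p₀ m + 2 * p₁ m = 1)
    (h29 : ∀ m, 1 ≤ m → a (m + 1) = a m + 2 * p₁ m * b (m + 1))
    (h210 : ∀ m, 1 ≤ m → b (m + 1) = 1 / 2 + a m + (p₀ m + p₁ m) * b (m + 1)) (h1 : a 1 = 1) :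
    ∀ n, 1 ≤ n → a n = ((3 : ℝ) ^ n - 1) / 2 :=
  recurrence_three_mul_add_one h1 fun m hm => eq_2_9_recurrence (hp m) (h29 m hm) (h210 m hm)

/-- A COROLLARY not displayed in the text (it is the formula for `p_2(n)` of [3],
arXiv:1304.3780): the solved form of (2.10) together with the two closed formulas determines
`p₁(m) = 3^(m-1) / (5^m - 3^m)` for `m ≥ 1`.
[cite: HinzKlavzarPetr2018, Ch. 2 §2.2.2 p. 119 (OUR COROLLARY; = p_2(n) of [3])] -/
theorem p₁_formula {m : ℕ} (hm : 1 ≤ m) {a' b p₁ : ℝ} (hsol : p₁ * b = 1 / 2 + a')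
    (ha' : a' = ((3 : ℝ) ^ m - 1) / 2) (hb : b = 3 * ((5 : ℝ) ^ m - 3 ^ m) / 2) :
    p₁ = (3 : ℝ) ^ (m - 1) / (5 ^ m - 3 ^ m) := by
  have h53 : (3 : ℝ) ^ m < 5 ^ m := pow_lt_pow_left₀ (by norm_num) (by norm_num) (by omega)
  have hne : (5 : ℝ) ^ m - 3 ^ m ≠ 0 := by linarith
  have h3m : (3 : ℝ) ^ m = 3 * 3 ^ (m - 1) := by
    rw [← pow_succ']
    congr 1
    omega
  rw [eq_div_iff hne]
  rw [ha', hb] at hsol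
  linear_combination (2 / 3 : ℝ) * hsol + (1 / 3 : ℝ) * h3m

/-! ### The numerical remarks -/

/-- The remark after Theorem 2.23: by the second formula a thoughtless person needs «an expected
number of approximately 576 008 moves already for the original 8-disc version of the TH» (`n = 8`;
the exact value is `2519459840 / 4374 ≈ 576 008.19`).
[cite: HinzKlavzarPetr2018, Ch. 2 §2.2.2 p. 118, remark after Thm. 2.23] -/
theorem remark_eight_discs :
    (576008 : ℝ) < ((3 : ℝ) ^ 8 - 1) * (5 ^ 8 - 3 ^ 8) / (2 * 3 ^ (8 - 1)) ∧
      ((3 : ℝ) ^ 8 - 1) * (5 ^ 8 - 3 ^ 8) / (2 * 3 ^ (8 - 1)) < 576008.2 := by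
  norm_num

/-- «For 4 discs, the number is about 806» (second formula, `n = 4`; the exact value is
`43520 / 54 ≈ 805.93`). [cite: HinzKlavzarPetr2018, Ch. 2 §2.2.2 p. 118, remark after Thm. 2.23] -/
theorem remark_four_discs :
    (805.9 : ℝ) < ((3 : ℝ) ^ 4 - 1) * (5 ^ 4 - 3 ^ 4) / (2 * 3 ^ (4 - 1)) ∧
      ((3 : ℝ) ^ 4 - 1) * (5 ^ 4 - 3 ^ 4) / (2 * 3 ^ (4 - 1)) < 806 := by
  norm_num

end Literature.Combinatorics.Hinz2018
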